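import Summits.Ventures.CertifiedArithmetic.LowPrec.SRKahanLaw
import HarnessLib

/-!
# Stochastic rounding into a finite format, XXXIV: the correction never saturates

HONEST FRAMING: certified error envelopes and provably optimal rounding/accumulation schemes for
low-precision formats under stated cost models; every table by two implementations; no hardware or
vendor claims.

Venture CertifiedArithmetic / lowprec, SR slice (gen8, part 3). Files XXIX–XXXIII analyse Kahan's
loop `y = SR(x − c)`, `t = SR(s + y)`, `d = SR(t − s)`, `c' = SR(d − y)` under the saturating
stochastic rounding of [ConnollyHighamMary2021, (2.1), (2.5)]; their hypothesis `NoSatK` asks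
that on every branch the arguments of the THREE small operations (y, d, c') lie in the hull of
`F`. This file removes one of the three for every value set that contains `0` and is closed
under negation (every format):

* `csub_inHull` — **the correction operation never saturates**: for `s, y ∈ F`, on every
  branch `t ∈ SR(s + y)`, `d ∈ SR(t − s)`, the argument `d − y` of the c-op lies in the hull.
  Mechanism: monotonicity of the saturating candidates through the representable points `s` and
  `0` — `y ≥ 0 ⇒ t ≥ s ⇒ d ≥ 0` (and symmetrically), so `d` and `y` never have opposite signs
  and `d − y ∈ [−|y|, |d|] ∪ [−|d|, |y|] ⊆ [−max F, max F]`.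
* `noSatK_iff_two` — hence from a representable state `s ∈ F`, `NoSatK` IS the two conditions
  "shifted summand `x − c` in the hull" and "recovery argument `t − s` in the hull" on every
  branch (`SmallOps F (InHull F) (InHull F) ⊤`); `valueSet_noSatK_iff_two` for every format.
* `stepSmall_of_dominant` — every format: in a step where the running sum dominates both
  candidates of the shifted summand (`|y| ≤ |s|`), the recovery is exact (file XXXI) and the ONLY
  condition left is `x − c` in the range.
* HONEST: the recovery condition is NOT removable in general — `e2m1_recovery_witness`: E2M1,
  state `(−1/2, 0)`, summand `6`: `x − c = 6` is in range, but on the branch `t = 6` the recovery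
  argument `t − s = 13/2 > 6` saturates and the corrected sum is BIASED, `E[s − c] = 47/8 ≠ 11/2`
  (kernel decision; the top-of-range effect of file XXXII's `2·max F` threshold seen from below).
-/

namespace Summit.Ventures.CertifiedArithmetic.LowPrec.SR

open Literature.ComputerArithmetic.ConnollyHighamMary2021
open Literature.ComputerArithmetic.FloatingPoint
open Literature.ComputerArithmetic.FloatingPoint.MiniFloat

section General

variable {K : Type*} [Field K] [LinearOrder K] [IsStrictOrderedRing K]

omit [IsStrictOrderedRing K] in
/-- `StepAll` is monotone in the predicate, the implication being allowed to use that the large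
addition's result `t` is a member of `F`. -/
theorem StepAll.mono_mem {F : Finset K} (hF : F.Nonempty) {x s c : K} {P Q : K → K → Prop}
    (hPQ : ∀ t c', t ∈ F → P t c' → Q t c') (h : StepAll F x s c P) : StepAll F x s c Q :=
  OnBoth.mono (fun _ hy => ⟨OnBoth.mono (fun _ hd => OnBoth.mono (fun c' hc =>
      hPQ _ c' (up_mem hF _) hc) hd) hy.1,
    OnBoth.mono (fun _ hd => OnBoth.mono (fun c' hc => hPQ _ c' (dn_mem hF _) hc) hd) hy.2⟩) h

/-- Representables of the same sign (in the weak sense `y ≥ 0 ⇒ d ≥ 0`, `y ≤ 0 ⇒ d ≤ 0`) have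
their difference in the hull, for `F` closed under negation. -/
theorem inHull_sub_of_sign {F : Finset K} (hsym : ∀ v ∈ F, -v ∈ F) {d y : K} (hd : d ∈ F)
    (hy : y ∈ F) (h₁ : 0 ≤ y → 0 ≤ d) (h₂ : y ≤ 0 → d ≤ 0) : InHull F (d - y) := by
  rcases le_total 0 y with h | h
  · have := h₁ h
    exact ⟨⟨-y, hsym y hy, by linarith⟩, d, hd, by linarith⟩
  · have := h₂ h
    exact ⟨⟨d, hd, by linarith⟩, -y, hsym y hy, by linarith⟩

/-- **The correction operation never saturates.** `0 ∈ F`, `F` closed under negation,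
`s, y ∈ F`: on every branch `t ∈ SR(s + y)`, `d ∈ SR(t − s)` the c-op argument `d − y` lies in
the hull of `F` (the large addition and the recovery MAY saturate — the clamp is monotone too). -/
theorem csub_inHull {F : Finset K} (h0 : (0 : K) ∈ F) (hsym : ∀ v ∈ F, -v ∈ F) {s y : K}
    (hs : s ∈ F) (hy : y ∈ F) :
    OnBoth F (s + y) fun t => OnBoth F (t - s) fun d => InHull F (d - y) := by
  have hF : F.Nonempty := ⟨0, h0⟩
  have hdu : ∀ e : K, dn F e ≤ up F e := fun e => roundDown_le_roundUp F _
  have ht : ∀ t : K, (0 ≤ y → s ≤ t) → (y ≤ 0 → t ≤ s) →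
      OnBoth F (t - s) fun d => InHull F (d - y) := by
    intro t g₁ g₂
    have hd : ∀ d ∈ F, (0 ≤ t - s → 0 ≤ d) → (t - s ≤ 0 → d ≤ 0) → InHull F (d - y) :=
      fun d hd k₁ k₂ => inHull_sub_of_sign hsym hd hy
        (fun h => k₁ (by linarith [g₁ h])) (fun h => k₂ (by linarith [g₂ h]))
    exact ⟨hd _ (up_mem hF _) (fun h => (le_dn_of_mem h0 h).trans (hdu _))
        (fun h => up_le_of_mem h0 h),
      hd _ (dn_mem hF _) (fun h => le_dn_of_mem h0 h)
        (fun h => (hdu _).trans (up_le_of_mem h0 h))⟩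
  exact ⟨ht _ (fun h => (le_dn_of_mem hs (by linarith)).trans (hdu _))
      (fun h => up_le_of_mem hs (by linarith)),
    ht _ (fun h => le_dn_of_mem hs (by linarith))
      (fun h => (hdu _).trans (up_le_of_mem hs (by linarith)))⟩

/-- **`NoSatK` from TWO conditions.** From a representable state `s ∈ F` (`0 ∈ F`, `F` closed
under negation), if on every branch the shifted summands `x_k − c_k` and the recovery arguments
`t_k − s_k` lie in the hull, then so do the correction arguments: `NoSatK` holds. -/
theorem noSatK_of_two {F : Finset K} (h0 : (0 : K) ∈ F) (hsym : ∀ v ∈ F, -v ∈ F) :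
    ∀ (n : ℕ) (x : ℕ → K) (s c : K), s ∈ F →
      SmallOps F (InHull F) (InHull F) (fun _ => True) x n s c → NoSatK F x n s c
  | 0, _, _, _, _, _ => trivial
  | n + 1, x, s, c, hs, h => by
      have hF : F.Nonempty := ⟨0, h0⟩
      obtain ⟨⟨h1, h2⟩, h3⟩ := h
      have key : ∀ y : K, y ∈ F →
          (OnBoth F (s + y) fun t => InHull F (t - s) ∧ OnBoth F (t - s) fun _ => True) →
          OnBoth F (s + y) fun t =>
            InHull F (t - s) ∧ OnBoth F (t - s) fun d => InHull F (d - y) :=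
        fun y hy h => (h.and (csub_inHull h0 hsym hs hy)).mono fun _ ht => ⟨ht.1.1, ht.2⟩
      exact ⟨⟨h1, key _ (up_mem hF _) h2.1, key _ (dn_mem hF _) h2.2⟩,
        h3.mono_mem hF fun t c' ht h => noSatK_of_two h0 hsym n _ t c' ht h⟩

/-- **`NoSatK` IS two conditions** (from a representable state): nothing is asked of the large
additions (file XXIX) and nothing of the corrections (this file). -/
theorem noSatK_iff_two {F : Finset K} (h0 : (0 : K) ∈ F) (hsym : ∀ v ∈ F, -v ∈ F)
    {x : ℕ → K} {n : ℕ} {s c : K} (hs : s ∈ F) :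
    NoSatK F x n s c ↔ SmallOps F (InHull F) (InHull F) (fun _ => True) x n s c :=
  ⟨fun h => SmallOps.mono (fun _ h => h) (fun _ h => h) (fun _ _ => trivial) x n s c h,
    noSatK_of_two h0 hsym n x s c hs⟩

/-- Consequently the exact unbiasedness of file XXIX needs only the two conditions. -/
theorem kahanExp_sub_of_two {F : Finset K} (h0 : (0 : K) ∈ F) (hsym : ∀ v ∈ F, -v ∈ F)
    {x : ℕ → K} {n : ℕ} {s c : K} (hs : s ∈ F)
    (h : SmallOps F (InHull F) (InHull F) (fun _ => True) x n s c) :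
    kahanExp F x n (fun s c => s - c) s c = s - c + ∑ i ∈ Finset.range n, x i :=
  kahanExp_sub_of_noSatK F x n s c (noSatK_of_two h0 hsym n x s c hs h)

end General

/-! ### Every format -/

section Formats

variable {φ : Format}

/-- Every format: `NoSatK` from a format value `s` is the two conditions (shifted summands and
recovery arguments in `[−maxRat, maxRat]`). -/
theorem valueSet_noSatK_iff_two {x : ℕ → ℚ} {n : ℕ} {s c : ℚ} (hs : s ∈ valueSet φ) :
    NoSatK (valueSet φ) x n s c ↔
      SmallOps (valueSet φ) (InHull (valueSet φ)) (InHull (valueSet φ)) (fun _ => True)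
        x n s c := by
  have h0 : (0 : ℚ) ∈ valueSet φ := by simpa using toRat_mem_valueSet (MiniFloat.zero φ)
  exact noSatK_iff_two h0 (fun v hv => neg_mem_valueSet hv) hs

/-- Every format, ONE step in which the running sum dominates: if `s ∈ F_φ`, the shifted summand
`x − c` is in range and both of its SR candidates `y` satisfy `|y| ≤ |s|`, then the recovery is
exact (`t − s ∈ F_φ`, file XXXI / `SRFaithful.dn_sub_mem`) and the correction cannot saturate:
all three small-operation conditions of the step hold. -/
theorem stepSmall_of_dominant {x s c : ℚ} (hs : s ∈ valueSet φ)
    (hx : InHull (valueSet φ) (x - c))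
    (hdom : OnBoth (valueSet φ) (x - c) fun y => |y| ≤ |s|) :
    StepSmall (valueSet φ) (InHull (valueSet φ)) (InHull (valueSet φ)) (InHull (valueSet φ))
      x s c := by
  have h0 : (0 : ℚ) ∈ valueSet φ := by simpa using toRat_mem_valueSet (MiniFloat.zero φ)
  have hF : (valueSet φ).Nonempty := ⟨0, h0⟩
  obtain ⟨a, rfl⟩ := mem_valueSet.mp hs
  have key : ∀ y : ℚ, y ∈ valueSet φ → |y| ≤ |a.toRat| →
      OnBoth (valueSet φ) (a.toRat + y) fun t => InHull (valueSet φ) (t - a.toRat) ∧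
        OnBoth (valueSet φ) (t - a.toRat) fun d => InHull (valueSet φ) (d - y) := by
    intro y hy hya
    obtain ⟨b, rfl⟩ := mem_valueSet.mp hy
    obtain ⟨hd, hu⟩ := dn_sub_mem a b hya
    have hc := csub_inHull h0 (fun v hv => neg_mem_valueSet hv) (toRat_mem_valueSet a) hy
    exact ⟨⟨inHull_of_mem hu, hc.1⟩, inHull_of_mem hd, hc.2⟩
  exact ⟨hx, key _ (up_mem hF _) hdom.1, key _ (dn_mem hF _) hdom.2⟩

end Formats

/-! ### Honest witness: the recovery condition is needed (kernel decision, FP4 `E2M1`) -/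

section Witness

open FP4 (e2m1)

/-- E2M1, state `(s, c) = (−1/2, 0)`, summand `6`: the shifted summand `6` is in range and the
correction never saturates, but on the branch `t = 6` of `SR(11/2)` the recovery argument
`t − s = 13/2 > 6 = max F` saturates: the two-condition test fails, `NoSatK` fails, and the
corrected sum is BIASED: `E[s − c] = 47/8 ≠ 11/2`. -/
theorem e2m1_recovery_witness :
    SmallOps e2m1 (InHull e2m1) (fun _ => True) (InHull e2m1) (fun _ => 6) 1 (-1 / 2) 0
    ∧ ¬ SmallOps e2m1 (InHull e2m1) (InHull e2m1) (fun _ => True) (fun _ => 6) 1 (-1 / 2) 0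
    ∧ ¬ NoSatK e2m1 (fun _ => 6) 1 (-1 / 2) 0
    ∧ kahanExp e2m1 (fun _ => 6) 1 (fun s c => s - c) (-1 / 2) 0 = 47 / 8 := by
  refine ⟨?_, ?_, ?_, ?_⟩ <;> decide +kernel

/-- The same over `valueSet E2M1`. -/
theorem valueSet_E2M1_recovery_witness :
    ¬ NoSatK (valueSet Format.E2M1) (fun _ => 6) 1 (-1 / 2) 0
    ∧ kahanExp (valueSet Format.E2M1) (fun _ => 6) 1 (fun s c => s - c) (-1 / 2) 0 = 47 / 8 := by
  rw [← e2m1_eq_valueSet]; exact ⟨e2m1_recovery_witness.2.2.1, e2m1_recovery_witness.2.2.2⟩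

end Witness

end Summit.Ventures.CertifiedArithmetic.LowPrec.SR
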